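import Literature.Analysis.FluidPDE.SereginSverakBlowupDecayProofs
import Literature.Analysis.FluidPDE.SereginSverakAxisDecayProofs
import Literature.Analysis.FluidPDE.NSBoundedInteriorRegularityAssembly
import Literature.Analysis.FluidPDE.NSBoundedSpatialHolderAssembly
import Literature.Analysis.FluidPDE.SereginSverakInteriorContinuityHolds
import Literature.Analysis.FluidPDE.SereginSverakLocalHolderProofs
import Literature.Analysis.FluidPDE.ParabolicSobolevHolderEmbeddingHolds
import Literature.Analysis.FluidPDE.KNSSThm53OfWindow
import HarnessLib

/-!
# Seregin–Šverák 2009, §4: the blow-up alternative and Theorem 3.2 from two library facts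

G. Seregin, V. Šverák, *On Type I singularities of the local axi-symmetric solutions of the
Navier–Stokes equations*, Comm. PDE 34 (2009), 171–201 = arXiv:0804.1803, §3 (Lemma 3.6,
Thm. 3.2) and §4 (arXiv pp. 10–11). The accepted named fact `SereginSverak2009.BlowupAlternative`
(`SereginSverakAxisymmetric.lean`; §4 read from its first sentence, the blow-up (p3)–(p11)
producing a non-zero bounded ancient axisymmetric weak solution with `|y'||u| ≤ A₂`) has the
accepted conditional discharge `blowupAlternative_of_facts : ScaledEnergyBound36 →
InteriorContinuity → BlowupCompactness → BlowupAlternative` (`SereginSverakBlowupDecay.lean`).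
Its three inputs now stand as follows in the tree:

* Lemma 3.6 with its uniformity, `ScaledEnergyBound36`, is PROVED: `ScaledEnergyBound36_holds`
  (`SereginSverakBlowupDecayProofs.lean`: the printed iteration with Remark 3.4, the weighted cubic
  estimate `exists_cubicC_le_of_axisDecay` for (as11) in the case `s = s₁, l = l₁`, the local
  energy estimate (as12) and the pressure decay (as13) from Stein's Proposition 3);
* `InteriorContinuity` (§4 ¶1 / §2 p. 8: bounded solutions are continuous inside) is reduced to
  Serrin's spatial regularity of bounded solutions, the named fact
  `Literature.Analysis.FluidPDE.NSBoundedSpatialHolder` (`interiorContinuity_of_spatialHolder`,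
  `NSBoundedInteriorRegularityAssembly.lean`; the energy class and the time continuity are proved
  there);
* `BlowupCompactness` (§4 (p5)–(p11)) is reduced to the uniform local Hölder bound of the local
  `L_p` theory of the Stokes system, the named fact `SereginSverak2009.LocalHolderBound`
  (`blowupCompactness_of_localHolderBound`, `SereginSverakBlowupCompactnessProofs.lean`).

This file records the resulting assembly: the blow-up alternative of §4 (the accepted
origin-centred rendering `BlowupAlternative`, which serves Thm. 3.1 and Thm. 3.2 alike — §4 is
one argument for both theorems) and Theorem 3.2 follow from the two library facts
`NSBoundedSpatialHolder` and `LocalHolderBound` (and, for Thm. 3.2, the Liouville theorem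
KNSS 2009, Thm. 5.3, `KNSS2009_liouville_bound_C_over_r`); and the `∃ Φ` rendering
`ScaledEnergyBoundOfAxisDecay` of Lemma 3.6 (`SereginSverakAxisDecay.lean`) is discharged
through the accepted `scaledEnergyBoundOfAxisDecay_of_bound36`. Theorem 3.2 is assembled through
`isRegularAtOrigin_of_axisDecay_of_blowupAlternative` of `SereginSverakAxisDecay.lean` (Lemma 3.6
at `b = 0` is the local (p1) of `BlowupAlternative`, (r4) is its local (p2)); the separate
Thm-3.2 rendering of the blow-up step formerly kept in that file was merged back into
`BlowupAlternative` (review of 2026-08-15: its antecedent was not load-bearing and its consequent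
is a corollary of `BlowupAlternative`), so no assembly here goes through it. The unconditional
`BlowupAlternative_holds` is `blowupAlternative_of_library_facts` applied to the `_holds`
theorems of the two facts once they land.

## The frontier after the discharges of 2026-08-15: one library fact

Both inputs of `blowupAlternative_of_library_facts` have since moved. Serrin's theorem is a
theorem of the tree (`NSBoundedSpatialHolder_holds`, `NSBoundedSpatialHolderAssembly.lean`; so is
the interior continuity it feeds, `InteriorContinuity_holds`,
`SereginSverakInteriorContinuityHolds.lean`), and of the two facts of the local theory of the
Stokes system behind `LocalHolderBound` (`localHolderBound_of : StokesLocalW21Estimate →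
StokesLocalHolderBound → LocalHolderBound`, `SereginSverakLocalHolderProofs.lean`) the second is
reduced to the first by the proved `StokesLocalHolderBound_of` (`SereginLocalStokesW21.lean`) and
the DISCHARGED parabolic embedding `ParabolicSobolevHolderEmbedding_holds`
(`ParabolicSobolevHolderEmbeddingHolds.lean`, Seregin 2014, Prop. 6.8). The last section of this
file records the consequence, everything proved: the uniform local Hölder bound
(`localHolderBound_of_stokesLocalW21Estimate`) and both renderings of the blow-up step of
§4 — `BlowupAlternative` (`blowupAlternative_of_stokesLocalW21Estimate`) and
`BlowupAlternativeTypeI` (`blowupAlternativeTypeI_of_stokesLocalW21Estimate`) — follow from the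
SINGLE named fact `Literature.Analysis.FluidPDE.StokesLocalW21Estimate` (Seregin 2014, §4.6,
Prop. 6.7, case `s = m` = the "local regularity theory for the Stokes system, see [S8]" invoked
three times on p. 11 of the paper); and, the Liouville theorem being a theorem as well
(`KNSS2009_liouville_bound_C_over_r_holds`, `KNSSThm53OfWindow.lean`), so does Theorem 3.2
(`isRegularAtOrigin_of_axisDecay_of_stokesLocalW21Estimate`). The trust base of
`BlowupAlternative` is thereby exactly `{StokesLocalW21Estimate}`, a fact that the corrected
Type I route of the barrier `AxisymmetricTypeIExclusion`
(`axisymmetricTypeIExclusion_of_offAxisBound_of_localHolderBound`) consumes anyway through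
`LocalHolderBound`: the origin-centred rendering carries no debt of its own. `BlowupAlternative_holds`
is `blowupAlternative_of_stokesLocalW21Estimate StokesLocalW21Estimate_holds` once Prop. 6.7 is
discharged.

## References

* G. Seregin, V. Šverák, Comm. PDE 34 (2009), 171–201, arXiv:0804.1803, §3 (Thm. 3.2,
  Lemma 3.6, arXiv pp. 9–10), §4 (p. 11). [`SereginSverak2009`]
* G. Koch, N. Nadirashvili, G. Seregin, V. Šverák, Acta Math. 203 (2009), Thm. 5.3.
  [`KochNadirashviliSereginSverak2009`]
* G. Seregin, *Lecture notes on regularity theory for the Navier–Stokes equations* (World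
  Scientific, 2014), §4.6, Prop. 6.7 (p. 58) and Prop. 6.8 (p. 60). [`Seregin2014`]
-/

noncomputable section

open MeasureTheory Set Function Filter Topology TopologicalSpace
open scoped NNReal ENNReal

namespace Literature.Analysis.FluidPDE

namespace SereginSverak2009

/-! ### Lemma 3.6 in its `∃ Φ` rendering, discharged -/

/-- **Seregin–Šverák 2009, Lemma 3.6 (the `∃ Φ` rendering), discharged**: the named fact
`ScaledEnergyBoundOfAxisDecay` of `SereginSverakAxisDecay.lean` holds — the accepted reduction
`scaledEnergyBoundOfAxisDecay_of_bound36` (`SereginSverakAxisDecayProofs.lean`) applied to the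
proved uniform form `ScaledEnergyBound36_holds` (`SereginSverakBlowupDecayProofs.lean`).
[cite: SereginSverak2009, Lemma 3.6 (asl5) with (as4)–(as5) (arXiv pp. 9–10)] -/
theorem ScaledEnergyBoundOfAxisDecay_holds : ScaledEnergyBoundOfAxisDecay :=
  scaledEnergyBoundOfAxisDecay_of_bound36 ScaledEnergyBound36_holds

/-! ### The blow-up alternative of §4 and Theorem 3.2 from two library facts -/

/-- **The blow-up alternative of §4 from two library facts.** The accepted named fact
`SereginSverak2009.BlowupAlternative` follows from Serrin's spatial regularity of bounded
solutions (`NSBoundedSpatialHolder`, giving `InteriorContinuity`) and the uniform local Hölder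
bound of the Stokes theory (`LocalHolderBound`, giving `BlowupCompactness`); Lemma 3.6 enters
through the proved `ScaledEnergyBound36_holds`.
[cite: SereginSverak2009, §4 (arXiv p. 11) with Lemma 3.6] -/
theorem blowupAlternative_of_library_facts (hSH : NSBoundedSpatialHolder)
    (hLHB : LocalHolderBound) : BlowupAlternative :=
  blowupAlternative_of_facts ScaledEnergyBound36_holds (interiorContinuity_of_spatialHolder hSH)
    (blowupCompactness_of_localHolderBound hLHB)

/-- **Seregin–Šverák 2009, Theorem 3.2, from the two library facts and KNSS 2009, Thm. 5.3**: an
axially symmetric distributional solution in `Q` with `u ∈ L³(Q)`, `p ∈ L^{3/2}(Q)`, (r2) and (r4)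
is regular at the origin — assembled as `isRegularAtOrigin_of_axisDecay_of_blowupAlternative` of
the statement file (Lemma 3.6 in its `∃ Φ` form, discharged above, supplies the origin-centred
local (p1) of `BlowupAlternative`; (r4) is its local (p2)), the blow-up alternative being
`blowupAlternative_of_library_facts`.
[cite: SereginSverak2009, Thm. 3.2 and §4 (arXiv pp. 9–11)] -/
theorem isRegularAtOrigin_of_axisDecay_of_library_facts (hSH : NSBoundedSpatialHolder)
    (hLHB : LocalHolderBound) (h53 : KNSS2009_liouville_bound_C_over_r)
    {u : ℝ → EuclideanSpace ℝ (Fin 3) → EuclideanSpace ℝ (Fin 3)}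
    {p : ℝ → EuclideanSpace ℝ (Fin 3) → ℝ} (hsol : IsAxisymmetricLocalSolution u p)
    (hb : IsBoundedAwayFromZero u) (hd : IsAxisDecayOnCyl u) : IsRegularAtOrigin u :=
  isRegularAtOrigin_of_axisDecay_of_blowupAlternative ScaledEnergyBoundOfAxisDecay_holds
    (blowupAlternative_of_library_facts hSH hLHB) h53 hsol hb hd

/-! ### The frontier: everything from Seregin 2014, Prop. 6.7 (`StokesLocalW21Estimate`) -/

/-- **The uniform local Hölder bound of §4 from Prop. 6.7 alone.** `LocalHolderBound`
(Seregin–Šverák 2009, §4, (p12) and the estimates following it: the blow-up sequence is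
"uniformly bounded in the parabolic Hölder space `C^{1/2}(Q̄(a/2))`") follows from the local
`W^{2,1}_{s,n}` estimate of the Stokes system `StokesLocalW21Estimate` (Seregin 2014, Prop. 6.7,
`s = m`): the accepted assembly `localHolderBound_of` fed with `StokesLocalHolderBound_of`, whose
second input, the parabolic embedding of Prop. 6.8, is the theorem
`ParabolicSobolevHolderEmbedding_holds`.
[cite: SereginSverak2009, §4 ((p12)ff, arXiv p. 11); Seregin2014, §4.6 Props. 6.7–6.8 (pp. 58–60)] -/
theorem localHolderBound_of_stokesLocalW21Estimate (h67 : StokesLocalW21Estimate) :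
    LocalHolderBound :=
  localHolderBound_of h67 (StokesLocalHolderBound_of h67 ParabolicSobolevHolderEmbedding_holds)

/-- **The compactness of the blow-up sequence (`BlowupCompactness`, §4 (p5)–(p11)) from Prop. 6.7
alone.** The named fact `SereginSverak2009.BlowupCompactness` (`SereginSverakBlowup.lean`: the
rescaled pairs `(u^k, p^k)` on `Q(R_k)`, `R_k → ∞`, with `|u^k| ≤ 1`, axial symmetry,
`|y'||u^k| ≤ A₂`, locally bounded `L_{3/2}` pressure and `|u^k(y_k, 0)| ≥ m`, have a non-zero
bounded ancient axisymmetric weak limit with the decay (p10)) needs no decomposition of its own: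
its elementary part — Arzelà–Ascoli, the diagonal subsequence, the passage to the limit in the
distributional identities, (p11) — is the accepted `blowupCompactness_of_localHolderBound`
(`SereginSverakBlowupCompactnessProofs.lean`), and its single analytic input, the uniform local
Hölder bound "sequence `u^k` is uniformly bounded in the parabolic Hölder space
`C^{1/2}(Q̄(a/2))`" (`LocalHolderBound`), is `localHolderBound_of_stokesLocalW21Estimate` above.
Hence the trust base of `BlowupCompactness` is exactly `{StokesLocalW21Estimate}` (Seregin 2014,
§4.6 Prop. 6.7, case `s = m` — "the local regularity theory for the Stokes system, see [S8]" of
p. 11 of the paper), and `BlowupCompactness_holds` is this theorem applied to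
`StokesLocalW21Estimate_holds` once Prop. 6.7 is discharged.
[cite: SereginSverak2009, §4 (p5)–(p12) and the estimates following (p12) (arXiv p. 11); Seregin2014, §4.6 Prop. 6.7 (p. 58) and §6.5 (p. 125)] -/
theorem blowupCompactness_of_stokesLocalW21Estimate (h67 : StokesLocalW21Estimate) :
    BlowupCompactness :=
  blowupCompactness_of_localHolderBound (localHolderBound_of_stokesLocalW21Estimate h67)

/-- **The blow-up alternative of §4 (`BlowupAlternative`) from Prop. 6.7 alone**:
`blowupAlternative_of_library_facts` fed with the discharged `NSBoundedSpatialHolder_holds` and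
`localHolderBound_of_stokesLocalW21Estimate`. `BlowupAlternative_holds` is this theorem applied to
`StokesLocalW21Estimate_holds` once that discharge lands.
[cite: SereginSverak2009, §4 ((p1)–(p11), arXiv p. 11); Seregin2014, §4.6 Prop. 6.7] -/
theorem blowupAlternative_of_stokesLocalW21Estimate (h67 : StokesLocalW21Estimate) :
    BlowupAlternative :=
  blowupAlternative_of_library_facts NSBoundedSpatialHolder_holds
    (localHolderBound_of_stokesLocalW21Estimate h67)

/-- **The Type I rendering `BlowupAlternativeTypeI` from Prop. 6.7 alone** (the blow-up step on
the corrected route of the barrier `AxisymmetricTypeIExclusion` = Thm. 3.1): the accepted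
`blowupAlternativeTypeI_of_localHolderBound'` (`SereginSverakInteriorContinuityHolds.lean`, with
`InteriorContinuity_holds`) fed with `localHolderBound_of_stokesLocalW21Estimate`.
[cite: SereginSverak2009, §4 (proof of Thm. 3.1, arXiv p. 11); Seregin2014, §4.6 Prop. 6.7] -/
theorem blowupAlternativeTypeI_of_stokesLocalW21Estimate (h67 : StokesLocalW21Estimate) :
    BlowupAlternativeTypeI :=
  blowupAlternativeTypeI_of_localHolderBound' (localHolderBound_of_stokesLocalW21Estimate h67)

/-- **Seregin–Šverák 2009, Theorem 3.2, from Prop. 6.7 alone**: an axially symmetric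
distributional solution in `Q` with `u ∈ L³(Q)`, `p ∈ L^{3/2}(Q)`, (r2) and the axis decay bound
(r4) is regular at the origin — `isRegularAtOrigin_of_axisDecay_of_library_facts` with
`NSBoundedSpatialHolder_holds`, `localHolderBound_of_stokesLocalW21Estimate` and the discharged
Liouville theorem `KNSS2009_liouville_bound_C_over_r_holds` (KNSS 2009, Thm. 5.3,
`KNSSThm53OfWindow.lean`).
[cite: SereginSverak2009, Thm. 3.2 and §4 (arXiv pp. 9–11); Seregin2014, §4.6 Prop. 6.7] -/
theorem isRegularAtOrigin_of_axisDecay_of_stokesLocalW21Estimate (h67 : StokesLocalW21Estimate)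
    {u : ℝ → EuclideanSpace ℝ (Fin 3) → EuclideanSpace ℝ (Fin 3)}
    {p : ℝ → EuclideanSpace ℝ (Fin 3) → ℝ} (hsol : IsAxisymmetricLocalSolution u p)
    (hb : IsBoundedAwayFromZero u) (hd : IsAxisDecayOnCyl u) : IsRegularAtOrigin u :=
  isRegularAtOrigin_of_axisDecay_of_library_facts NSBoundedSpatialHolder_holds
    (localHolderBound_of_stokesLocalW21Estimate h67) KNSS2009_liouville_bound_C_over_r_holds
    hsol hb hd

end SereginSverak2009

end Literature.Analysis.FluidPDE
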